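import Literature.LinearAlgebra.QuadraticForm.PositiveProjections
import HarnessLib

/-!
# Stabilisers of points of `X⁺` in the arithmetic group are finite

Topic `LinearAlgebra/QuadraticForm`, companion of `QuadraticForm/PosComplexStructuresConnected`.
Setting of [Deligne1982HodgeCycles, proof of Thm. 4.8, pp. 48–50]: a finite-dimensional real
space `V = V(ℝ)`, the action `k` of `√-d`, an alternating form `ψ`, the period domain
`X⁺ = posComplexStructures k ψ` of `k`-linear `ψ`-positive complex structures, and a lattice
`V(ℤ) = Λ ⊂ V`. The group `Γ` of automorphisms of `(V(ℤ), ψ)` commuting with the `𝒪_E`-action acts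
on `X⁺` by `J ↦ g J g⁻¹` (p. 50), and the quotient `Γ\X⁺` by a torsion-free congruence subgroup
(level `n ≥ 3`, Minkowski–Serre) is the smooth base of the algebraic family. The step that makes
the torsion-free group act FREELY is the classical finiteness of the stabilisers — the automorphism
group of the polarized abelian variety `(A_J, θ, ν)` at the point `J`
([Lange2023AbelianVarietiesComplex], Cor. 2.4.10: "The group of automorphisms of any polarized
abelian variety is finite", proved there exactly this way: a discrete set meeting a compact one;
Cor. 2.4.11: an automorphism trivial on the `n`-torsion, `n ≥ 3`, is the identity): an automorphism
`g` fixing `J` preserves `ψ` and commutes with `J`, hence preserves the POSITIVE DEFINITE form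
`b (x) = ψ (x, J x)`; so it is bounded, and a bounded set of lattice endomorphisms is finite.

* `continuous_apply_self` — `x ↦ ψ (x, T x)` is continuous (finite dimension);
* `exists_pos_mul_norm_sq_le`, `exists_le_mul_norm_sq` — a continuous, degree-two homogeneous,
  positive function is squeezed between positive multiples of `‖x‖²` (compact unit sphere);
* `norm_le_of_apply_self_eq` — maps preserving such a function are uniformly bounded;
* `finite_setOf_isometry_commute_mapsTo` — MAIN: for `J ∈ X⁺` and a `ℤ`-lattice `Λ`, the set of
  `g ∈ End V` with `ψ (g x, g y) = ψ (x, y)`, `g J = J g`, `g Λ ⊆ Λ` is FINITE (so its intersection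
  with a torsion-free subgroup of `GL(V)` is trivial, `eq_one_of_commute_of_torsionFree`).

Everything is proved, Mathlib only (`IsZLattice`, `finite_isBounded_inter_isClosed`); no
definitions, no named facts. Deliberately NOT here: proper discontinuity of `Γ` on `X⁺`, the
manifold structure of `Γ\X⁺`.

## References

* [Deligne1982HodgeCycles] P. Deligne (notes by J. S. Milne), Hodge cycles on abelian varieties,
  LNM 900 (1982), proof of Thm. 4.8, p. 50.
* [Lange2023AbelianVarietiesComplex] H. Lange, Abelian Varieties over the Complex Numbers: A
  Graduate Course, Grundlehren Text Editions, Springer 2023 (text edition of Lange–Birkenhake,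
  Complex Abelian Varieties, Grundlehren 302), Ch. 2 §2.4, Cor. 2.4.10 and Cor. 2.4.11 (held in the
  literature store under the key `book:lange1992-complex-abelian-varieties`, chunks 116–117; the
  theorem numbers are those of the 2023 text edition).
-/

noncomputable section

namespace Literature.LinearAlgebra.QuadraticForm

open Module Set Metric

variable {V : Type*} [NormedAddCommGroup V] [NormedSpace ℝ V]

/-! ### Positive homogeneous functions of degree two are comparable to `‖x‖²` -/

/-- `x ↦ ψ (x, T x)` is continuous on a finite-dimensional space. [folklore] -/
theorem continuous_apply_self [FiniteDimensional ℝ V] (ψ : LinearMap.BilinForm ℝ V)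
    (T : V →L[ℝ] V) : Continuous fun x => ψ x (T x) := by
  let Ψ : V →L[ℝ] (V →L[ℝ] ℝ) :=
    LinearMap.toContinuousLinearMap
      ((LinearMap.toContinuousLinearMap : (V →ₗ[ℝ] ℝ) ≃ₗ[ℝ] (V →L[ℝ] ℝ)).toLinearMap ∘ₗ ψ)
  have h : Continuous fun x => Ψ x (T x) := by fun_prop
  exact h

/-- `b 0 = 0` for a degree-two homogeneous `b`. [folklore] -/
theorem apply_zero_of_homogeneous {b : V → ℝ} (h2 : ∀ (t : ℝ) (x : V), b (t • x) = t ^ 2 * b x) :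
    b 0 = 0 := by
  have h := h2 0 0
  rwa [zero_smul, zero_pow two_ne_zero, zero_mul] at h

/-- **Coercivity.** A continuous function, homogeneous of degree two and positive away from `0`,
is bounded below by `c ‖x‖²` with `c > 0` (minimum on the compact unit sphere). [folklore] -/
theorem exists_pos_mul_norm_sq_le [FiniteDimensional ℝ V] {b : V → ℝ} (hb : Continuous b)
    (h2 : ∀ (t : ℝ) (x : V), b (t • x) = t ^ 2 * b x) (hpos : ∀ x, x ≠ 0 → 0 < b x) :
    ∃ c : ℝ, 0 < c ∧ ∀ x, c * ‖x‖ ^ 2 ≤ b x := by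
  have hb0 := apply_zero_of_homogeneous h2
  rcases subsingleton_or_nontrivial V with hV | hV
  · refine ⟨1, one_pos, fun x => ?_⟩
    rw [Subsingleton.elim x 0, hb0, norm_zero, zero_pow two_ne_zero, mul_zero]
  · obtain ⟨x₀, hx₀, hmin⟩ := (isCompact_sphere (0 : V) 1).exists_isMinOn
      ((NormedSpace.sphere_nonempty (E := V)).2 zero_le_one) hb.continuousOn
    have hx₀0 : x₀ ≠ 0 := by
      intro h
      rw [h, mem_sphere_zero_iff_norm, norm_zero] at hx₀
      exact zero_ne_one hx₀
    refine ⟨b x₀, hpos x₀ hx₀0, fun x => ?_⟩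
    rcases eq_or_ne x 0 with rfl | hx
    · rw [hb0, norm_zero, zero_pow two_ne_zero, mul_zero]
    · have hnx : 0 < ‖x‖ := norm_pos_iff.2 hx
      have hu : ‖x‖⁻¹ • x ∈ sphere (0 : V) 1 := by
        rw [mem_sphere_zero_iff_norm, norm_smul, norm_inv, norm_norm, inv_mul_cancel₀ hnx.ne']
      have h3 : b x₀ ≤ b (‖x‖⁻¹ • x) := isMinOn_iff.1 hmin _ hu
      rw [h2, inv_pow] at h3
      have h4 : 0 < ‖x‖ ^ 2 := by positivity
      calc b x₀ * ‖x‖ ^ 2 ≤ (‖x‖ ^ 2)⁻¹ * b x * ‖x‖ ^ 2 :=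
            mul_le_mul_of_nonneg_right h3 h4.le
        _ = b x := by field_simp

/-- **Upper bound.** A continuous function homogeneous of degree two is bounded above by
`C ‖x‖²` (maximum on the compact unit sphere). [folklore] -/
theorem exists_le_mul_norm_sq [FiniteDimensional ℝ V] {b : V → ℝ} (hb : Continuous b)
    (h2 : ∀ (t : ℝ) (x : V), b (t • x) = t ^ 2 * b x) :
    ∃ C : ℝ, 0 ≤ C ∧ ∀ x, b x ≤ C * ‖x‖ ^ 2 := by
  have hb0 := apply_zero_of_homogeneous h2
  rcases subsingleton_or_nontrivial V with hV | hV
  · refine ⟨0, le_rfl, fun x => ?_⟩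
    rw [Subsingleton.elim x 0, hb0, zero_mul]
  · obtain ⟨x₁, hx₁, hmax⟩ := (isCompact_sphere (0 : V) 1).exists_isMaxOn
      ((NormedSpace.sphere_nonempty (E := V)).2 zero_le_one) hb.continuousOn
    refine ⟨max (b x₁) 0, le_max_right _ _, fun x => ?_⟩
    rcases eq_or_ne x 0 with rfl | hx
    · rw [hb0, norm_zero, zero_pow two_ne_zero, mul_zero]
    · have hnx : 0 < ‖x‖ := norm_pos_iff.2 hx
      have hu : ‖x‖⁻¹ • x ∈ sphere (0 : V) 1 := by
        rw [mem_sphere_zero_iff_norm, norm_smul, norm_inv, norm_norm, inv_mul_cancel₀ hnx.ne']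
      have h3 : b (‖x‖⁻¹ • x) ≤ b x₁ := isMaxOn_iff.1 hmax _ hu
      rw [h2, inv_pow] at h3
      have h4 : 0 < ‖x‖ ^ 2 := by positivity
      calc b x = (‖x‖ ^ 2)⁻¹ * b x * ‖x‖ ^ 2 := by field_simp
        _ ≤ b x₁ * ‖x‖ ^ 2 := mul_le_mul_of_nonneg_right h3 h4.le
        _ ≤ max (b x₁) 0 * ‖x‖ ^ 2 := mul_le_mul_of_nonneg_right (le_max_left _ _) h4.le

/-- **Maps preserving a positive function are uniformly bounded**: if `c ‖x‖² ≤ b x ≤ C ‖x‖²`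
with `c > 0` and `b (g x) = b x` for all `x`, then `‖g x‖ ≤ √(C/c) ‖x‖`. [folklore] -/
theorem norm_le_of_apply_self_eq {b : V → ℝ} {c C : ℝ} (hc : 0 < c) (hC : 0 ≤ C)
    (hcb : ∀ x, c * ‖x‖ ^ 2 ≤ b x) (hCb : ∀ x, b x ≤ C * ‖x‖ ^ 2) {g : V →L[ℝ] V}
    (hg : ∀ x, b (g x) = b x) (x : V) : ‖g x‖ ≤ Real.sqrt (C / c) * ‖x‖ := by
  have h1 : c * ‖g x‖ ^ 2 ≤ C * ‖x‖ ^ 2 := by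
    calc c * ‖g x‖ ^ 2 ≤ b (g x) := hcb (g x)
      _ = b x := hg x
      _ ≤ C * ‖x‖ ^ 2 := hCb x
  have h2 : ‖g x‖ ^ 2 ≤ C / c * ‖x‖ ^ 2 := by
    rw [div_mul_eq_mul_div, le_div_iff₀ hc]
    linarith
  calc ‖g x‖ = Real.sqrt (‖g x‖ ^ 2) := (Real.sqrt_sq (norm_nonneg _)).symm
    _ ≤ Real.sqrt (C / c * ‖x‖ ^ 2) := Real.sqrt_le_sqrt h2
    _ = Real.sqrt (C / c) * ‖x‖ := by
        rw [Real.sqrt_mul (div_nonneg hC hc.le), Real.sqrt_sq (norm_nonneg _)]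

/-! ### Finiteness of the stabiliser of a point of `X⁺` among lattice endomorphisms -/

section Lattice

variable [FiniteDimensional ℝ V] {k : V →L[ℝ] V} {ψ : LinearMap.BilinForm ℝ V}

/-- **The stabiliser of `J ∈ X⁺` in the endomorphisms of `(Λ, ψ)` is finite.** For `J` a
`ψ`-positive complex structure (`J ∈ posComplexStructures k ψ`) and `Λ ⊂ V` a full `ℤ`-lattice,
the set of `g ∈ End V` preserving `ψ`, commuting with `J` and mapping `Λ` into itself is finite:
such `g` preserve the positive definite `b (x) = ψ (x, J x)`, hence `‖g x‖ ≤ K ‖x‖` uniformly, and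
`g` is determined by the images of a `ℤ`-basis of `Λ`, which lie in the finite sets
`Λ ∩ B(0, K ‖eᵢ‖)`. This is the linear algebra of "the group of automorphisms of any polarized
abelian variety is finite" (the automorphisms of the member `(A_J, θ, ν)` of Deligne's family at
`J`), which makes a torsion-free `Γ` act freely on `X⁺` ([Deligne1982HodgeCycles] p. 50).
[cite: Lange2023AbelianVarietiesComplex, Ch. 2 §2.4 Cor. 2.4.10] -/
theorem finite_setOf_isometry_commute_mapsTo {J : V →L[ℝ] V} (hJ : J ∈ posComplexStructures k ψ)
    (Λ : Submodule ℤ V) [DiscreteTopology Λ] [IsZLattice ℝ Λ] :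
    {g : V →L[ℝ] V | (∀ x y, ψ (g x) (g y) = ψ x y) ∧ Commute g J ∧ ∀ v ∈ Λ, g v ∈ Λ}.Finite := by
  obtain ⟨-, -, -, hJpos⟩ := hJ
  -- the positive definite form `b x = ψ (x, J x)` and its comparison with `‖x‖²`
  set b : V → ℝ := fun x => ψ x (J x) with hb
  have hbc : Continuous b := continuous_apply_self ψ J
  have hb2 : ∀ (t : ℝ) (x : V), b (t • x) = t ^ 2 * b x := fun t x => by
    simp only [hb, map_smul, LinearMap.smul_apply, smul_eq_mul]
    ring
  obtain ⟨c, hc, hcb⟩ := exists_pos_mul_norm_sq_le hbc hb2 hJpos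
  obtain ⟨C, hC, hCb⟩ := exists_le_mul_norm_sq hbc hb2
  set K : ℝ := Real.sqrt (C / c)
  have hK : ∀ g ∈ {g : V →L[ℝ] V | (∀ x y, ψ (g x) (g y) = ψ x y) ∧ Commute g J ∧
      ∀ v ∈ Λ, g v ∈ Λ}, ∀ x, ‖g x‖ ≤ K * ‖x‖ := by
    rintro g ⟨hgψ, hgJ, -⟩ x
    refine norm_le_of_apply_self_eq hc hC hcb hCb (fun y => ?_) x
    have hJg : J (g y) = g (J y) := (DFunLike.congr_fun hgJ.eq y).symm
    simp only [hb, hJg, hgψ]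
  -- a `ℤ`-basis of `Λ`, which is an `ℝ`-basis of `V`
  let ι := Module.Free.ChooseBasisIndex ℤ Λ
  let bΛ : Basis ι ℤ Λ := Module.Free.chooseBasis ℤ Λ
  let B : Basis ι ℝ V := bΛ.ofZLatticeBasis ℝ Λ
  have hBmem : ∀ i, B i ∈ Λ := fun i => by
    rw [Basis.ofZLatticeBasis_apply]
    exact (bΛ i).2
  -- the finite target: tuples of lattice vectors of bounded norm
  have hclosed : IsClosed (Λ : Set V) := AddSubgroup.isClosed_of_discrete (H := Λ.toAddSubgroup)
  have hdisc : IsDiscrete (Λ : Set V) := SetLike.isDiscrete_iff_discreteTopology.mpr inferInstance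
  have hT : (Set.univ.pi fun i : ι => closedBall (0 : V) (K * ‖B i‖) ∩ (Λ : Set V)).Finite :=
    Set.Finite.pi fun i => finite_isBounded_inter_isClosed hdisc isBounded_closedBall hclosed
  -- `g ↦ (g eᵢ)ᵢ` is injective
  let F : (V →L[ℝ] V) → (ι → V) := fun g i => g (B i)
  have hF : Function.Injective F := fun g g' h =>
    ContinuousLinearMap.coe_inj.1 (B.ext fun i => congr_fun h i)
  refine (hT.preimage hF.injOn).subset fun g hg => ?_
  simp only [Set.mem_preimage, Set.mem_univ_pi, Set.mem_inter_iff, mem_closedBall, dist_zero_right,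
    SetLike.mem_coe]
  exact fun i => ⟨hK g hg (B i), hg.2.2 _ (hBmem i)⟩

/-- An element of a group all of whose powers lie in a finite set has finite order. [folklore] -/
theorem isOfFinOrder_of_forall_pow_mem {M : Type*} [Group M] {S : Set M} (hS : S.Finite) {g : M}
    (h : ∀ n : ℕ, g ^ n ∈ S) : IsOfFinOrder g := by
  obtain ⟨a, b, hab, he⟩ := hS.exists_lt_map_eq_of_forall_mem h
  rw [isOfFinOrder_iff_pow_eq_one]
  refine ⟨b - a, by omega, ?_⟩
  rw [pow_sub _ hab.le, ← he, mul_inv_cancel]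

/-- **A torsion-free group of automorphisms of `(Λ, ψ)` acts freely on `X⁺`.** If `G` is a
subgroup of `GL(V)` preserving `ψ` and the lattice `Λ` and without non-trivial elements of finite
order (e.g. the congruence subgroup `Γ(n)`, `n ≥ 3`, of [Deligne1982HodgeCycles] p. 50, by
Minkowski–Serre), then an element of `G` commuting with a point `J ∈ X⁺` (i.e. fixing it under
`J ↦ g J g⁻¹`) is the identity: its powers lie in the finite stabiliser
(`finite_setOf_isometry_commute_mapsTo`), so it has finite order. (Cf.
[Lange2023AbelianVarietiesComplex, Cor. 2.4.11]: an automorphism of a polarized abelian variety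
trivial on the `n`-torsion, `n ≥ 3`, is the identity.) [folklore] -/
theorem eq_one_of_commute_of_torsionFree {J : V →L[ℝ] V} (hJ : J ∈ posComplexStructures k ψ)
    (Λ : Submodule ℤ V) [DiscreteTopology Λ] [IsZLattice ℝ Λ] {G : Subgroup (V →L[ℝ] V)ˣ}
    (hGψ : ∀ g ∈ G, ∀ x y, ψ ((g : V →L[ℝ] V) x) ((g : V →L[ℝ] V) y) = ψ x y)
    (hGΛ : ∀ g ∈ G, ∀ v ∈ Λ, (g : V →L[ℝ] V) v ∈ Λ) (htf : ∀ g ∈ G, IsOfFinOrder g → g = 1)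
    {g : (V →L[ℝ] V)ˣ} (hg : g ∈ G) (hgJ : Commute (g : V →L[ℝ] V) J) : g = 1 := by
  apply htf g hg
  have hS := (finite_setOf_isometry_commute_mapsTo hJ Λ).preimage
    (f := fun u : (V →L[ℝ] V)ˣ => (u : V →L[ℝ] V)) Units.val_injective.injOn
  refine isOfFinOrder_of_forall_pow_mem hS fun n => ?_
  simp only [Set.mem_preimage, Set.mem_setOf_eq, Units.val_pow_eq_pow_val]
  exact ⟨fun x y => by rw [← Units.val_pow_eq_pow_val]; exact hGψ _ (G.pow_mem hg n) x y,
    hgJ.pow_left n,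
    fun v hv => by rw [← Units.val_pow_eq_pow_val]; exact hGΛ _ (G.pow_mem hg n) v hv⟩

end Lattice

end Literature.LinearAlgebra.QuadraticForm
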